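import Summits.FinalStateConjecture.FinalStateConjecture.Theses.ExactKerrEnds
import Summits.FinalStateConjecture.FinalStateConjecture.Theorems.PhaseMixingCaptureWeakCosmicCensorshipMGHDStubScriTransfer
import Summits.FinalStateConjecture.FinalStateConjecture.Theorems.SwallowTheDatumSubdataDevelopmentsEmbedLocalisationHolds
import Summits.FinalStateConjecture.FinalStateConjecture.Theorems.ExactKerrEndsSettlingAlongCensoredKerrEndsShape
import Literature.Geometry.Lorentzian.StabilityCauchy
import Literature.Geometry.Lorentzian.KerrStabilitySubextremalCauchy
import Literature.Geometry.Lorentzian.InitialDataLocality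
import Literature.Geometry.Lorentzian.KerrSliceFacts
import HarnessLib

/-!
# Crux `CensorshipAlongKerrEnds` (stmt-FinalStateConjecture-18521): the black-hole corner, PERTURBATIVE
# form — a datum whose exterior sub-datum on a horizon-penetrating Kerr–Schild slice lies in a
# Kerr-stability basin is censored, whatever it is inside

Companion of `…KerrShielded.lean` (exactly shielded data).  The mechanism is isolated as an unconditional
transfer lemma and then fed by the two Kerr-stability named facts of the tree:

* `censored_of_subslice_farComplete` — EXTERIOR CERTIFICATION PRINCIPLE (granted exterior ignorance,
  `SwallowTheDatum.SubdataDevelopmentsEmbed`, stmt-10053, by name): if `Φ : Kerr.slice a r₀ → X` is a smooth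
  open embedding of a truncated Kerr–Schild slice into the data manifold whose image of the closed far region
  is co-compact in `X`, and SOME vacuum Cauchy development `𝒦` of the exterior sub-datum `Φ^* d` has complete
  `𝓘⁺` as seen from the far region (`HasCompleteFutureNullInfinityFar`, sojourn form), then `d` is censored —
  every maximal vacuum Cauchy development of `d` has complete `𝓘⁺` (`Summit.FinalStateConjecture.
  HasCompleteNullInfinity`).  Exterior ignorance embeds `𝒦` over `Φ`, and far-origin sojourn completeness
  ascends along the embedding (`stub_scriTransfer`, crux 9952); the interior of `d` is never inspected.
* `censored_of_klainermanSzeftelBasin` — CONDITIONAL on `choquetBruhat_geroch_exists_mghd_cauchy`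
  (Choquet-Bruhat–Geroch 1969) and `klainerman_szeftel_kerr_stability_small_a_cauchy` (Klainerman–Szeftel
  2023, refereed): for the `(s, δ, a₀)` of the fact and every slowly rotating `(M, a)`, `|a| < a₀ M`, and
  inner radius `r₀ ∈ (r₋, r₊)`, there is `ε > 0` such that every admissible datum admitting such a `Φ` with
  `Φ^* d` `ε`-close to the Kerr–Schild slice data `Kerr.data M a r₀` in `H^s_δ × H^{s-1}_{δ+1}` is censored.
* `censored_of_hintzBasin` — the same over the FULL SUB-EXTREMAL RANGE, conditional on the Choquet-Bruhat–
  Geroch fact and the unrefereed claim `hintz_kerr_stability_subextremal_cauchy` (Hintz 2026), in that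
  fact's quantifier shape (b-conormal data balls, locally uniform in the spin).
* `censorshipAlongKerrEnds_constCase_of_klainermanSzeftelBasin` / `…_of_hintzBasin` — hence the CONSTANT
  CASE of the crux at every admissible KERR-ENDED base in the respective basin (breathing self-witness,
  `kerrEndedCensoredSelfWitness`).

With `…NearMinkowski.lean` (dispersive corner, CK), `…NonposMassCensored.lean` (massless corner, PMT) and
`…KerrShielded.lean` (exactly shielded corner) this exhausts what printed stability theorems certify: the
crux is open exactly in the collapse regime between the Minkowski basin and the Kerr basins.

References: Klainerman–Szeftel, PAMQ 19 (2023), Thm. 1.2.1; Hintz, arXiv:2606.28253, Thm. 1.1 / Thm. 13.1;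
Christodoulou, CQG 16 (1999) A23, pp. A24–A27; Dafermos–Rodnianski arXiv:0811.0354 §2.6.2, §5.1;
Choquet-Bruhat–Geroch, CMP 14 (1969), Thm. 3; Hawking–Ellis 1973, §7.6.
-/

-- the doubled `FinalStateConjecture.FinalStateConjecture` path component trips dupNamespace
set_option linter.dupNamespace false

noncomputable section

open Set Function Filter TopologicalSpace
open scoped Manifold ContDiff Topology

namespace Summit.FinalStateConjecture.FinalStateConjecture.Theorems.ExactKerrEnds.CensorshipAlongKerrEnds

open Literature.Geometry.Lorentzian
open Summit.FinalStateConjecture (HasCompleteNullInfinity)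
open Summit.FinalStateConjecture.FinalStateConjecture.Theses.SwallowTheDatum (SubdataDevelopmentsEmbed)
open Summit.FinalStateConjecture.FinalStateConjecture.Theorems.PhaseMixingCapture.WeakCosmicCensorshipMGHD
  (stub_scriTransfer)
open Summit.FinalStateConjecture.FinalStateConjecture.Theorems.SubdataDevelopmentsEmbed
  (subdataDevelopmentsEmbed_of_choquetBruhatGeroch)

variable {X : Type} [TopologicalSpace X] [ChartedSpace E3 X] [IsManifold (𝓡 3) ∞ X] [T2Space X]
  [SecondCountableTopology X] [ConnectedSpace X]

/-! ## §1 The exterior certification principle -/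

/-- **Exterior certification of censoredness** (granted exterior ignorance, `SubdataDevelopmentsEmbed`):
let `Φ : Kerr.slice a r₀ → X` be a `C^{∞+1}` open embedding with injective differentials whose image of the
closed far region `{R + 1 ≤ ‖y‖}` is co-compact in `X`, and let `𝒦` be ANY vacuum Cauchy development of the
exterior sub-datum `Φ^* d` with complete `𝓘⁺` as seen from the far region (sojourn form,
`HasCompleteFutureNullInfinityFar`).  Then every maximal vacuum Cauchy development `𝒟` of `d` has complete
`𝓘⁺`: exterior ignorance gives a time-oriented isometric open embedding `χ : 𝒦 → 𝒟` over `Φ`; the compact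
sets `B₀, B₁ ⊆ Kerr.slice a r₀` of `𝒦`'s far completeness are pushed to `Φ '' B₀` and `K ∪ Φ '' B₁` in `X`
(`Φ` injective), and the lever `stub_scriTransfer` lifts normalised null rays of `𝒟` from far origins to
`𝒦` and compares affine domains and sojourn times.  Hawking–Ellis 1973, §7.6; Christodoulou, CQG 16
(1999), pp. A26–A27. -/
theorem censored_of_subslice_farComplete (hE : SubdataDevelopmentsEmbed) [Kerr.SliceFacts]
    {d : InitialDataSet (𝓡 3) X} {a r₀ : ℝ} (Φ : Kerr.slice a r₀ → X)
    (hΦ : ContMDiff (𝓡 3) (𝓡 3) (∞ + 1) Φ) (hΦ' : ∀ u, Injective (mfderiv (𝓡 3) (𝓡 3) Φ u))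
    (hΦo : Topology.IsOpenEmbedding Φ)
    (hK : ∃ K : Set X, IsCompact K ∧ Kᶜ ⊆ Φ '' range (Kerr.farSliceIncl a r₀))
    (𝒦 : VacuumCauchyDevelopment (d.comap Φ hΦ hΦ')) (hfar : 𝒦.HasCompleteFutureNullInfinityFar) :
    ∀ 𝒟 : VacuumCauchyDevelopment d, 𝒟.IsMaximal → HasCompleteNullInfinity 𝒟.toCauchyDevelopment := by
  intro 𝒟 hmax
  obtain ⟨K, hKc, hKΦ⟩ := hK
  -- exterior ignorance: `𝒦` embeds into the maximal development over `Φ`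
  obtain ⟨χ, hχ, hχo, hiso, hτ, hcomm⟩ := hE X d 𝒟 hmax (Kerr.slice a r₀) Φ hΦ hΦ' hΦo 𝒦
  intro hLC
  refine stub_scriTransfer X d 𝒟.toCauchyDevelopment (Kerr.slice a r₀) Φ hΦ hΦ' hΦo
    𝒦.toDataEmbedding χ hχ hχo hiso hτ hcomm K hKc
    (hKΦ.trans (image_subset_range _ _)) ?_
  intro _instK
  obtain ⟨B₀, hB₀, H⟩ := @hfar _instK
  refine ⟨Φ '' B₀, hB₀.image hΦo.continuous, fun s hs ↦ ?_⟩
  obtain ⟨B₁, hB₁, H₁⟩ := H s hs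
  refine ⟨K ∪ Φ '' B₁, hKc.union (hB₁.image hΦo.continuous), fun p hp γ dom hγ ↦ ?_⟩
  -- the origin is a far point: `Φ p ∉ K`, so `Φ p ∈ Φ '' (far region)`, and `Φ` is injective
  have hpfar : p ∈ range (Kerr.farSliceIncl a r₀) := by
    obtain ⟨q, hq, hqp⟩ := hKΦ (fun h ↦ hp (Or.inl h))
    rwa [← hΦo.injective hqp]
  have hpB₁ : p ∉ B₁ := fun h ↦ hp (Or.inr (mem_image_of_mem Φ h))
  rw [hΦo.injective.preimage_image]
  exact H₁ p hpfar hpB₁ γ dom hγ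

/-- **Exterior certification, granted the Choquet-Bruhat–Geroch theorem**: the same with exterior ignorance
discharged from the named fact `choquetBruhat_geroch_exists_mghd_cauchy` (`subdataDevelopmentsEmbed_of_
choquetBruhatGeroch`), and with the certifying development taken to be a MAXIMAL development of the
exterior sub-datum of the admissible `d`, which that fact provides (the sub-datum solves the vacuum constraints,
`isVacuumConstraintSolution_comap'`): if EVERY maximal vacuum Cauchy development of `Φ^* d` has complete far
`𝓘⁺` — the conclusion shape of the Kerr-stability facts — then `d` is censored.  CONDITIONAL on the one named
fact.  [cite: ChoquetBruhatGeroch1969CMP, Thm. 3 and p. 334] -/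
theorem censored_of_subslice_forall_maximal_farComplete (hcbg : choquetBruhat_geroch_exists_mghd_cauchy)
    [Kerr.SliceFacts] {d : InitialDataSet (𝓡 3) X} (hd : d ∈ admissibleVacuumData X) {a r₀ : ℝ}
    (Φ : Kerr.slice a r₀ → X) (hΦ : ContMDiff (𝓡 3) (𝓡 3) (∞ + 1) Φ)
    (hΦ' : ∀ u, Injective (mfderiv (𝓡 3) (𝓡 3) Φ u)) (hΦo : Topology.IsOpenEmbedding Φ)
    (hK : ∃ K : Set X, IsCompact K ∧ Kᶜ ⊆ Φ '' range (Kerr.farSliceIncl a r₀))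
    (hfar : ∀ 𝒦 : VacuumCauchyDevelopment (d.comap Φ hΦ hΦ'), 𝒦.IsMaximal →
      𝒦.HasCompleteFutureNullInfinityFar) :
    ∀ 𝒟 : VacuumCauchyDevelopment d, 𝒟.IsMaximal → HasCompleteNullInfinity 𝒟.toCauchyDevelopment := by
  haveI : d.metric.HasLeviCivita := d.metric.hasLeviCivita
  haveI : (d.comap Φ hΦ hΦ').metric.HasLeviCivita := (d.comap Φ hΦ hΦ').metric.hasLeviCivita
  have hvac' : (d.comap Φ hΦ hΦ').IsVacuumConstraintSolution :=
    d.isVacuumConstraintSolution_comap' hΦ hΦ' hd.1.1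
  obtain ⟨𝒦, h𝒦⟩ := hcbg (Kerr.slice a r₀) (d.comap Φ hΦ hΦ') hvac'
  exact censored_of_subslice_farComplete (subdataDevelopmentsEmbed_of_choquetBruhatGeroch hcbg) Φ hΦ hΦ'
    hΦo hK 𝒦 (hfar 𝒦 h𝒦)

/-! ## §2 The Klainerman–Szeftel basin (slowly rotating Kerr; refereed) -/

/-- **Data whose exterior lies in the Klainerman–Szeftel basin are censored** — CONDITIONAL on
`choquetBruhat_geroch_exists_mghd_cauchy` (Choquet-Bruhat–Geroch 1969, Thm. 3) and
`klainerman_szeftel_kerr_stability_small_a_cauchy` (Klainerman–Szeftel, PAMQ 19 (2023), Thm. 1.2.1, faithful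
Cauchy consequence form).  For the exponents `(s, δ)` and spin bound `a₀` of the fact, every slowly rotating
`(M, a)` (`0 < M`, `|a| < a₀ M`) and inner radius `r₀ ∈ (r₋(M,a), r₊(M,a))` admit `ε > 0` such that: an
admissible datum `d` on `X` carrying a `C^{∞+1}` open embedding `Φ : Kerr.slice a r₀ → X` with injective
differentials and co-compact far image, whose exterior sub-datum `Φ^* d` is `ε`-close to the Kerr–Schild
slice data `Kerr.data M a r₀` in `H^s_δ × H^{s-1}_{δ+1}`, is CENSORED — whatever `d` is on the compact
remainder.  The fact gives complete far `𝓘⁺` for every maximal development of `Φ^* d`;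
`censored_of_subslice_forall_maximal_farComplete` transfers.
[cite: KlainermanSzeftel2023, Thm. 1.2.1] [cite: ChoquetBruhatGeroch1969CMP, Thm. 3 and p. 334] -/
theorem censored_of_klainermanSzeftelBasin (hcbg : choquetBruhat_geroch_exists_mghd_cauchy) [Kerr.Facts]
    [Kerr.SliceFacts] (hKS : klainerman_szeftel_kerr_stability_small_a_cauchy) :
    ∃ (s : ℕ) (δ : ℝ), ∃ a₀ > (0 : ℝ), ∀ (M a : ℝ) (hM : 0 < M), |a| < a₀ * M →
      ∀ r₀ ∈ Set.Ioo (Kerr.rMinus M a) (Kerr.rPlus M a), ∃ ε > (0 : ℝ),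
        ∀ d ∈ admissibleVacuumData X, ∀ (Φ : Kerr.slice a r₀ → X)
          (hΦ : ContMDiff (𝓡 3) (𝓡 3) (∞ + 1) Φ) (hΦ' : ∀ u, Injective (mfderiv (𝓡 3) (𝓡 3) Φ u)),
          Topology.IsOpenEmbedding Φ →
          (∃ K : Set X, IsCompact K ∧ Kᶜ ⊆ Φ '' range (Kerr.farSliceIncl a r₀)) →
          InitialDataSet.dataWeightedSobolevEDist s δ (d.comap Φ hΦ hΦ') (Kerr.data M a r₀ hM.le) <
            ENNReal.ofReal ε →
          ∀ 𝒟 : VacuumCauchyDevelopment d, 𝒟.IsMaximal →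
            HasCompleteNullInfinity 𝒟.toCauchyDevelopment := by
  obtain ⟨s, δ, _k, a₀, ha₀, H⟩ := hKS
  refine ⟨s, δ, a₀, ha₀, fun M a hM ha r₀ hr₀ ↦ ?_⟩
  obtain ⟨ε, hε, C, HD⟩ := H M a hM ha r₀ hr₀
  refine ⟨ε, hε, fun d hd Φ hΦ hΦ' hΦo hK hdist ↦ ?_⟩
  haveI : d.metric.HasLeviCivita := d.metric.hasLeviCivita
  haveI : (d.comap Φ hΦ hΦ').metric.HasLeviCivita := (d.comap Φ hΦ hΦ').metric.hasLeviCivita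
  have hvac' : (d.comap Φ hΦ hΦ').IsVacuumConstraintSolution :=
    d.isVacuumConstraintSolution_comap' hΦ hΦ' hd.1.1
  have hfar : ∀ 𝒦 : VacuumCauchyDevelopment (d.comap Φ hΦ hΦ'), 𝒦.IsMaximal →
      𝒦.HasCompleteFutureNullInfinityFar := by
    intro 𝒦 h𝒦
    obtain ⟨M', a', 𝒟oc, _hsub, hscri, _hconv, _hpar⟩ := HD (d.comap Φ hΦ hΦ') hvac' hdist 𝒦 h𝒦
    exact hscri
  exact censored_of_subslice_forall_maximal_farComplete hcbg hd Φ hΦ hΦ' hΦo hK hfar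

/-- **THE CONSTANT CASE OF THE CRUX AT A KERR-ENDED BASE IN THE KLAINERMAN–SZEFTEL BASIN** (conditional
on the Choquet-Bruhat–Geroch fact and the Klainerman–Szeftel fact): with `(s, δ, a₀)` and `ε(M, a, r₀)` as in
`censored_of_klainermanSzeftelBasin`, through every admissible KERR-ENDED datum whose exterior sub-datum on
some co-compactly embedded `Kerr.slice a r₀` is `ε`-close to `Kerr.data M a r₀` passes a tame, injective,
immersed curve of admissible data all of whose members are Kerr-ended and censored — the conclusion of
`CensorshipAlongKerrEnds` at that base (its breathing curve, `kerrEndedCensoredSelfWitness`).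
[cite: KlainermanSzeftel2023, Thm. 1.2.1] [cite: Christodoulou1999, p. A24] -/
theorem censorshipAlongKerrEnds_constCase_of_klainermanSzeftelBasin
    (hcbg : choquetBruhat_geroch_exists_mghd_cauchy) [Kerr.Facts] [Kerr.SliceFacts]
    (hKS : klainerman_szeftel_kerr_stability_small_a_cauchy) :
    ∃ (s : ℕ) (δ : ℝ), ∃ a₀ > (0 : ℝ), ∀ (M a : ℝ) (hM : 0 < M), |a| < a₀ * M →
      ∀ r₀ ∈ Set.Ioo (Kerr.rMinus M a) (Kerr.rPlus M a), ∃ ε > (0 : ℝ),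
        ∀ d ∈ admissibleVacuumData X, d.HasExactKerrEnd → ∀ (Φ : Kerr.slice a r₀ → X)
          (hΦ : ContMDiff (𝓡 3) (𝓡 3) (∞ + 1) Φ) (hΦ' : ∀ u, Injective (mfderiv (𝓡 3) (𝓡 3) Φ u)),
          Topology.IsOpenEmbedding Φ →
          (∃ K : Set X, IsCompact K ∧ Kᶜ ⊆ Φ '' range (Kerr.farSliceIncl a r₀)) →
          InitialDataSet.dataWeightedSobolevEDist s δ (d.comap Φ hΦ hΦ') (Kerr.data M a r₀ hM.le) <
            ENNReal.ofReal ε →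
          ∃ (e' : AFEnd X) (F' : EuclideanSpace ℝ (Fin 1) → InitialDataSet (𝓡 3) X),
            InitialDataSet.IsTameDataFamily e' 1 F' ∧ F' 0 = d ∧ Injective F' ∧
              InitialDataSet.IsImmersedAtZero 1 F' ∧ (∀ c, F' c ∈ admissibleVacuumData X) ∧
                ∀ c, (F' c).HasExactKerrEnd ∧
                  ∀ 𝒟 : VacuumCauchyDevelopment (F' c), 𝒟.IsMaximal →
                    HasCompleteNullInfinity 𝒟.toCauchyDevelopment := by
  obtain ⟨s, δ, a₀, ha₀, H⟩ := censored_of_klainermanSzeftelBasin (X := X) hcbg hKS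
  refine ⟨s, δ, a₀, ha₀, fun M a hM ha r₀ hr₀ ↦ ?_⟩
  obtain ⟨ε, hε, Hε⟩ := H M a hM ha r₀ hr₀
  exact ⟨ε, hε, fun d hd hKE Φ hΦ hΦ' hΦo hK hdist ↦
    kerrEndedCensoredSelfWitness hd hKE (Hε d hd Φ hΦ hΦ' hΦo hK hdist)⟩

/-! ## §3 The Hintz basin (full sub-extremal range; unrefereed claim) -/

/-- **Data whose exterior lies in the Hintz basin are censored** — CONDITIONAL on
`choquetBruhat_geroch_exists_mghd_cauchy` and on the UNREFEREED CLAIM `hintz_kerr_stability_subextremal_cauchy`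
(Hintz, arXiv:2606.28253, Thm. 1.1 / Thm. 13.1, Cauchy consequence form), in that fact's quantifier shape:
for every normalised sub-extremal centre `χ₀` and normalised inner radius `ρ₀` between the horizons there are
exponents `(s, δ)` and a spin radius `ς > 0`, and for every mass `M > 0` ONE `ε > 0` serving all spins with
`|a/M − χ₀| < ς` at `r₀ = ρ₀ M`: an admissible datum `d` carrying a co-compact `C^{∞+1}` open embedding
`Φ : Kerr.slice a r₀ → X` with injective differentials whose exterior sub-datum is b-conormal relative to
`Kerr.data M a r₀` at weight `δ` (finite distance at every order) and `ε`-close at order `s` is CENSORED.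
[cite: Hintz2026, Thm. 1.1 (p. 2); Thm. 13.1 (pp. 318–319)] [cite: ChoquetBruhatGeroch1969CMP, Thm. 3 and p. 334] -/
theorem censored_of_hintzBasin (hcbg : choquetBruhat_geroch_exists_mghd_cauchy) [Kerr.Facts]
    [Kerr.SliceFacts] (hH : hintz_kerr_stability_subextremal_cauchy) :
    ∀ χ₀ : ℝ, |χ₀| < 1 → ∀ ρ₀ ∈ Set.Ioo (1 - √(1 - χ₀ ^ 2)) (1 + √(1 - χ₀ ^ 2)),
      ∃ (s : ℕ) (δ : ℝ), ∃ ς > (0 : ℝ), ∀ (M : ℝ) (hM : 0 < M), ∃ ε > (0 : ℝ),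
        ∀ a r₀ : ℝ, |a / M - χ₀| < ς → r₀ = ρ₀ * M →
          r₀ ∈ Set.Ioo (Kerr.rMinus M a) (Kerr.rPlus M a) →
          ∀ d ∈ admissibleVacuumData X, ∀ (Φ : Kerr.slice a r₀ → X)
            (hΦ : ContMDiff (𝓡 3) (𝓡 3) (∞ + 1) Φ) (hΦ' : ∀ u, Injective (mfderiv (𝓡 3) (𝓡 3) Φ u)),
            Topology.IsOpenEmbedding Φ →
            (∃ K : Set X, IsCompact K ∧ Kᶜ ⊆ Φ '' range (Kerr.farSliceIncl a r₀)) →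
            (∀ s' : ℕ, InitialDataSet.dataWeightedSobolevEDist s' δ (d.comap Φ hΦ hΦ')
              (Kerr.data M a r₀ hM.le) < ⊤) →
            InitialDataSet.dataWeightedSobolevEDist s δ (d.comap Φ hΦ hΦ') (Kerr.data M a r₀ hM.le) <
              ENNReal.ofReal ε →
            ∀ 𝒟 : VacuumCauchyDevelopment d, 𝒟.IsMaximal →
              HasCompleteNullInfinity 𝒟.toCauchyDevelopment := by
  intro χ₀ hχ₀ ρ₀ hρ₀
  obtain ⟨s, δ, _k, ς, hς, H⟩ := hH χ₀ hχ₀ ρ₀ hρ₀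
  refine ⟨s, δ, ς, hς, fun M hM ↦ ?_⟩
  obtain ⟨ε, hε, Hε⟩ := H M hM 1 one_pos
  refine ⟨ε, hε, fun a r₀ ha hr₀ hr d hd Φ hΦ hΦ' hΦo hK hcon hdist ↦ ?_⟩
  haveI : d.metric.HasLeviCivita := d.metric.hasLeviCivita
  haveI : (d.comap Φ hΦ hΦ').metric.HasLeviCivita := (d.comap Φ hΦ hΦ').metric.hasLeviCivita
  have hvac' : (d.comap Φ hΦ hΦ').IsVacuumConstraintSolution :=
    d.isVacuumConstraintSolution_comap' hΦ hΦ' hd.1.1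
  have hfar : ∀ 𝒦 : VacuumCauchyDevelopment (d.comap Φ hΦ hΦ'), 𝒦.IsMaximal →
      𝒦.HasCompleteFutureNullInfinityFar := by
    intro 𝒦 h𝒦
    obtain ⟨M', a', 𝒟oc, _hsub, _hpar, hscri, _hconv⟩ :=
      Hε a r₀ ha hr₀ hr (d.comap Φ hΦ hΦ') hvac' hcon hdist 𝒦 h𝒦
    exact hscri
  exact censored_of_subslice_forall_maximal_farComplete hcbg hd Φ hΦ hΦ' hΦo hK hfar

/-- **THE CONSTANT CASE OF THE CRUX AT A KERR-ENDED BASE IN THE HINTZ BASIN** (conditional on the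
Choquet-Bruhat–Geroch fact and the unrefereed Hintz claim): in the quantifier shape of `censored_of_hintzBasin`,
through every admissible KERR-ENDED datum in the basin passes a tame, injective, immersed curve of admissible
data all of whose members are Kerr-ended and censored (`kerrEndedCensoredSelfWitness`).
[cite: Hintz2026, Thm. 1.1 (p. 2); Thm. 13.1 (pp. 318–319)] [cite: Christodoulou1999, p. A24] -/
theorem censorshipAlongKerrEnds_constCase_of_hintzBasin (hcbg : choquetBruhat_geroch_exists_mghd_cauchy)
    [Kerr.Facts] [Kerr.SliceFacts] (hH : hintz_kerr_stability_subextremal_cauchy) :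
    ∀ χ₀ : ℝ, |χ₀| < 1 → ∀ ρ₀ ∈ Set.Ioo (1 - √(1 - χ₀ ^ 2)) (1 + √(1 - χ₀ ^ 2)),
      ∃ (s : ℕ) (δ : ℝ), ∃ ς > (0 : ℝ), ∀ (M : ℝ) (hM : 0 < M), ∃ ε > (0 : ℝ),
        ∀ a r₀ : ℝ, |a / M - χ₀| < ς → r₀ = ρ₀ * M →
          r₀ ∈ Set.Ioo (Kerr.rMinus M a) (Kerr.rPlus M a) →
          ∀ d ∈ admissibleVacuumData X, d.HasExactKerrEnd → ∀ (Φ : Kerr.slice a r₀ → X)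
            (hΦ : ContMDiff (𝓡 3) (𝓡 3) (∞ + 1) Φ) (hΦ' : ∀ u, Injective (mfderiv (𝓡 3) (𝓡 3) Φ u)),
            Topology.IsOpenEmbedding Φ →
            (∃ K : Set X, IsCompact K ∧ Kᶜ ⊆ Φ '' range (Kerr.farSliceIncl a r₀)) →
            (∀ s' : ℕ, InitialDataSet.dataWeightedSobolevEDist s' δ (d.comap Φ hΦ hΦ')
              (Kerr.data M a r₀ hM.le) < ⊤) →
            InitialDataSet.dataWeightedSobolevEDist s δ (d.comap Φ hΦ hΦ') (Kerr.data M a r₀ hM.le) <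
              ENNReal.ofReal ε →
            ∃ (e' : AFEnd X) (F' : EuclideanSpace ℝ (Fin 1) → InitialDataSet (𝓡 3) X),
              InitialDataSet.IsTameDataFamily e' 1 F' ∧ F' 0 = d ∧ Injective F' ∧
                InitialDataSet.IsImmersedAtZero 1 F' ∧ (∀ c, F' c ∈ admissibleVacuumData X) ∧
                  ∀ c, (F' c).HasExactKerrEnd ∧
                    ∀ 𝒟 : VacuumCauchyDevelopment (F' c), 𝒟.IsMaximal →
                      HasCompleteNullInfinity 𝒟.toCauchyDevelopment := by
  intro χ₀ hχ₀ ρ₀ hρ₀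
  obtain ⟨s, δ, ς, hς, H⟩ := censored_of_hintzBasin (X := X) hcbg hH χ₀ hχ₀ ρ₀ hρ₀
  refine ⟨s, δ, ς, hς, fun M hM ↦ ?_⟩
  obtain ⟨ε, hε, Hε⟩ := H M hM
  exact ⟨ε, hε, fun a r₀ ha hr₀ hr d hd hKE Φ hΦ hΦ' hΦo hK hcon hdist ↦
    kerrEndedCensoredSelfWitness hd hKE (Hε a r₀ ha hr₀ hr d hd Φ hΦ hΦ' hΦo hK hcon hdist)⟩

end Summit.FinalStateConjecture.FinalStateConjecture.Theorems.ExactKerrEnds.CensorshipAlongKerrEnds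

end
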